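import Summits.FinalStateConjecture.FinalStateConjecture.Theorems.PhotonSphereChannelsBlindnessWaveCalculus
import Literature.Analysis.FluidPDE.SpaceTimeCalculusC1

/-!
# Route PhotonSphereChannels · BlindnessInsidePhotonSphere — energy identities for `C²`
# solutions of `φ_tt − φ_xx + V φ = F` with spatially compact support

Support file (pure analysis, everything proved) for item stmt-FinalStateConjecture-10049.
For `uncurry φ ∈ C²(ℝ²)` vanishing outside the domain of influence `{α − |t| ≤ x ≤ β + |t|}`,
`V ∈ C¹`, and a `C¹` weight `χ`, the weighted energy
`G(s) = ∫ χ(x − s) e(s, x) dx`, `e = φ_t² + φ_x² + Vφ²`, is differentiable with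

  `G'(s) = ∫ (2 χ(x−s) φ_t F − χ'(x−s) (e + 2 φ_t φ_x)) dx`,  `F = φ_tt − φ_xx + Vφ`

(`hasDerivAt_weightedEnergy`: differentiation under the integral sign, the pointwise identity
`∂_t e = 2φ_t F + 2∂_x(φ_tφ_x)` and one integration by parts). Consequences:
the energy inequality `E(t) ≤ (e − 1) T² N²` on `[0, T]` for zero data and `‖F(t)‖₂² ≤ N²`
(`energy_le_of_forcing`, Grönwall), and, for solutions (`F = 0`, `V ≥ 0`) and non-decreasing
`χ`, that `G` is non-increasing (`antitone_weightedEnergy`) — the outgoing flux through a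
right-moving null line is `(φ_t + φ_x)² + Vφ² ≥ 0` (Evans, *PDE*, §2.4.3; Alinhac,
*Hyperbolic PDE*, Thm. 6.3). No definitions are introduced.
-/

noncomputable section

open Set Filter MeasureTheory Topology Function

namespace Summit.FinalStateConjecture.FinalStateConjecture.Theorems.Blindness

/-! ### Compactly supported continuous integrands -/

/-- A continuous function vanishing off `[a, b]` (strictly outside) has compact support. -/
theorem hasCompactSupport_of_exterior {g : ℝ → ℝ} {a b : ℝ}
    (h0 : ∀ x, (x < a ∨ b < x) → g x = 0) : HasCompactSupport g := by
  refine HasCompactSupport.intro (isCompact_Icc (a := a) (b := b)) fun x hx => h0 x ?_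
  by_contra h
  exact hx ⟨le_of_not_gt fun h' => h (Or.inl h'), le_of_not_gt fun h' => h (Or.inr h')⟩

/-- A continuous function vanishing off `[a, b]` is integrable. -/
theorem integrable_of_exterior {g : ℝ → ℝ} {a b : ℝ} (hg : Continuous g)
    (h0 : ∀ x, (x < a ∨ b < x) → g x = 0) : Integrable g :=
  hg.integrable_of_hasCompactSupport (hasCompactSupport_of_exterior h0)

/-- A function vanishing off `[a, b]` tends to `0` at `−∞` and at `+∞`. -/
theorem tendsto_zero_of_exterior {g : ℝ → ℝ} {a b : ℝ}
    (h0 : ∀ x, (x < a ∨ b < x) → g x = 0) :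
    Tendsto g atBot (𝓝 0) ∧ Tendsto g atTop (𝓝 0) := by
  constructor
  · refine tendsto_const_nhds.congr' ?_
    filter_upwards [eventually_lt_atBot a] with x hx using (h0 x (Or.inl hx)).symm
  · refine tendsto_const_nhds.congr' ?_
    filter_upwards [eventually_gt_atTop b] with x hx using (h0 x (Or.inr hx)).symm

section WeightedEnergy

variable {φ : ℝ → ℝ → ℝ} {V : ℝ → ℝ} {α β : ℝ}

/-- At a fixed time, all the fields of a `C²` function vanishing outside the domain of influence
vanish for `x < α − |s|` or `x > β + |s|`: the function itself, its two first partials and the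
derivatives of the first-partial fields. -/
theorem fields_eq_zero_of_exterior (hφ : ContDiff ℝ 2 (uncurry φ))
    (h0 : ∀ t x, (x < α - |t| ∨ β + |t| < x) → φ t x = 0) {s x : ℝ}
    (hx : x < α - |s| ∨ β + |s| < x) (v w : ℝ × ℝ) :
    φ s x = 0 ∧ fderiv ℝ (uncurry φ) (s, x) v = 0 ∧
      fderiv ℝ (uncurry fun t y => fderiv ℝ (uncurry φ) (t, y) v) (s, x) w = 0 := by
  refine ⟨h0 s x hx, fderiv_eq_zero_of_exterior h0 hx v, ?_⟩
  have _ := hφ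
  exact fderiv_eq_zero_of_exterior (φ := fun t y => fderiv ℝ (uncurry φ) (t, y) v)
    (fderiv_field_eq_zero_of_exterior h0 v) hx w

/-- **Derivative of the weighted energy.** For `uncurry φ ∈ C²` vanishing outside the domain of
influence of `[α, β]`, `V, χ ∈ C¹`:
`d/ds ∫ χ(x−s) e(s,x) dx = ∫ (2χ(x−s) φ_t F − χ'(x−s)(e + 2φ_tφ_x)) dx` with
`e = φ_t² + φ_x² + Vφ²`, `F = φ_tt − φ_xx + Vφ` (all partials in `fderiv` form). -/
theorem hasDerivAt_weightedEnergy (hφ : ContDiff ℝ 2 (uncurry φ)) (hV : ContDiff ℝ 1 V)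
    (h0 : ∀ t x, (x < α - |t| ∨ β + |t| < x) → φ t x = 0) {χ : ℝ → ℝ} (hχ : ContDiff ℝ 1 χ)
    (s : ℝ) :
    HasDerivAt (fun s => ∫ x, χ (x - s) * (fderiv ℝ (uncurry φ) (s, x) (1, 0) ^ 2
        + fderiv ℝ (uncurry φ) (s, x) (0, 1) ^ 2 + V x * φ s x ^ 2))
      (∫ x, (2 * χ (x - s) * (fderiv ℝ (uncurry φ) (s, x) (1, 0)
          * (fderiv ℝ (uncurry fun t y => fderiv ℝ (uncurry φ) (t, y) (1, 0)) (s, x) (1, 0)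
            - fderiv ℝ (uncurry fun t y => fderiv ℝ (uncurry φ) (t, y) (0, 1)) (s, x) (0, 1)
            + V x * φ s x))
        - deriv χ (x - s) * ((fderiv ℝ (uncurry φ) (s, x) (1, 0) ^ 2
          + fderiv ℝ (uncurry φ) (s, x) (0, 1) ^ 2 + V x * φ s x ^ 2)
          + 2 * (fderiv ℝ (uncurry φ) (s, x) (1, 0) * fderiv ℝ (uncurry φ) (s, x) (0, 1))))) s := by
  -- names for the fields
  set ft : ℝ → ℝ → ℝ := fun t y => fderiv ℝ (uncurry φ) (t, y) (1, 0) with hft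
  set fx : ℝ → ℝ → ℝ := fun t y => fderiv ℝ (uncurry φ) (t, y) (0, 1) with hfx
  set ftt : ℝ → ℝ → ℝ := fun t y => fderiv ℝ (uncurry ft) (t, y) (1, 0) with hftt
  set ftx : ℝ → ℝ → ℝ := fun t y => fderiv ℝ (uncurry ft) (t, y) (0, 1) with hftx
  set fxt : ℝ → ℝ → ℝ := fun t y => fderiv ℝ (uncurry fx) (t, y) (1, 0) with hfxt
  set fxx : ℝ → ℝ → ℝ := fun t y => fderiv ℝ (uncurry fx) (t, y) (0, 1) with hfxx
  have hft1 : ContDiff ℝ 1 (uncurry ft) := contDiff_one_fderiv_apply hφ (1, 0)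
  have hfx1 : ContDiff ℝ 1 (uncurry fx) := contDiff_one_fderiv_apply hφ (0, 1)
  have hφ1 : ContDiff ℝ 1 (uncurry φ) := hφ.of_le (by norm_num)
  -- time slab and compact spatial container
  set T : ℝ := |s| + 1 with hT
  set S : Set ℝ := Ioo (-T) T with hS
  have hsS : s ∈ S := by
    rw [hS, mem_Ioo, hT]; constructor <;> linarith [neg_abs_le s, le_abs_self s]
  have hSabs : ∀ t ∈ S, |t| < T := fun t ht => abs_lt.2 ⟨ht.1, ht.2⟩
  set K : Set ℝ := Icc (α - T) (β + T) with hK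
  have hKout : ∀ t ∈ S, ∀ x ∉ K, x < α - |t| ∨ β + |t| < x := by
    intro t ht x hx
    have h' : x < α - T ∨ β + T < x := by
      by_contra h
      exact hx ⟨le_of_not_gt fun h' => h (Or.inl h'), le_of_not_gt fun h' => h (Or.inr h')⟩
    have := hSabs t ht
    rcases h' with h' | h'
    · left; linarith
    · right; linarith
  -- the integrand `Φ t x = χ(x - t) e(t, x)` is jointly `C¹` and supported in `K`
  set Φ : ℝ → ℝ → ℝ := fun t x => χ (x - t) * (ft t x ^ 2 + fx t x ^ 2 + V x * φ t x ^ 2)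
    with hΦ
  have hΦ1 : ContDiff ℝ 1 (uncurry Φ) := by
    have hχ' : ContDiff ℝ 1 fun p : ℝ × ℝ => χ (p.2 - p.1) :=
      hχ.comp (contDiff_snd.sub contDiff_fst)
    have hV' : ContDiff ℝ 1 fun p : ℝ × ℝ => V p.2 := hV.comp contDiff_snd
    exact hχ'.mul (((hft1.pow 2).add (hfx1.pow 2)).add (hV'.mul (hφ1.pow 2)))
  have hΦsupp : ∀ t ∈ S, ∀ x ∉ K, Φ t x = 0 := by
    intro t ht x hx
    obtain ⟨h1, h2, -⟩ := fields_eq_zero_of_exterior hφ h0 (hKout t ht x hx) (1, 0) (1, 0)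
    obtain ⟨-, h3, -⟩ := fields_eq_zero_of_exterior hφ h0 (hKout t ht x hx) (0, 1) (1, 0)
    simp only [hΦ, hft, hfx, h1, h2, h3]; ring
  -- differentiation under the integral sign
  have hD := Literature.Analysis.FluidPDE.hasDerivAt_integral_of_contDiffOn (μ := volume)
    (Φ := Φ) (isOpen_Ioo (a := -T) (b := T)) hΦ1.contDiffOn isCompact_Icc hΦsupp hsS
  -- the pointwise time derivative of `Φ`
  have hpt : ∀ x, HasDerivAt (fun t => Φ t x)
      (-deriv χ (x - s) * (ft s x ^ 2 + fx s x ^ 2 + V x * φ s x ^ 2)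
        + χ (x - s) * (2 * ft s x * ftt s x + 2 * fx s x * fxt s x
          + V x * (2 * φ s x * ft s x))) s := by
    intro x
    have h1 : HasDerivAt (fun t => χ (x - t)) (-deriv χ (x - s)) s := by
      have hi : HasDerivAt (fun t : ℝ => x - t) (-1) s := by
        simpa using (hasDerivAt_id s).const_sub x
      have h := ((hχ.differentiable one_ne_zero) (x - s)).hasDerivAt.comp s hi
      exact (h.congr_of_eventuallyEq (Eventually.of_forall fun t => rfl)).congr_deriv (by ring)
    have h2 := hasDerivAt_energyDensity_time (V := V) hφ s x
    exact ((h1.mul h2).congr_of_eventuallyEq (Eventually.of_forall fun t => rfl)).congr_deriv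
      (by simp only [hft, hfx, hftt, hfxt])
  have hderiv_eq : (fun x => deriv (fun t => Φ t x) s) = fun x =>
      (2 * χ (x - s) * (ft s x * (ftt s x - fxx s x + V x * φ s x))
        - deriv χ (x - s) * ((ft s x ^ 2 + fx s x ^ 2 + V x * φ s x ^ 2) + 2 * (ft s x * fx s x)))
      + 2 * (χ (x - s) * (ftx s x * fx s x + ft s x * fxx s x) + deriv χ (x - s)
          * (ft s x * fx s x)) := by
    funext x
    rw [(hpt x).deriv]
    have hid := energyDensity_time_identity (V := V) hφ s x
    simp only [hft, hfx, hftt, hfxt, hftx, hfxx] at hid ⊢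
    rw [hid]; ring
  -- support and integrability of the pieces at time `s`
  have hout : ∀ x, (x < α - |s| ∨ β + |s| < x) →
      φ s x = 0 ∧ ft s x = 0 ∧ fx s x = 0 ∧ ftt s x = 0 ∧ ftx s x = 0 ∧ fxx s x = 0 := by
    intro x hx
    obtain ⟨h1, h2, h3⟩ := fields_eq_zero_of_exterior hφ h0 hx (1, 0) (1, 0)
    obtain ⟨-, h4, h5⟩ := fields_eq_zero_of_exterior hφ h0 hx (0, 1) (0, 1)
    obtain ⟨-, -, h6⟩ := fields_eq_zero_of_exterior hφ h0 hx (1, 0) (0, 1)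
    exact ⟨h1, h2, h4, h3, h6, h5⟩
  have hcφ : Continuous (φ s) := hφ.continuous.comp (Continuous.prodMk_right s)
  have hcft : Continuous (ft s) := hft1.continuous.comp (Continuous.prodMk_right s)
  have hcfx : Continuous (fx s) := hfx1.continuous.comp (Continuous.prodMk_right s)
  have hcftt : Continuous (ftt s) :=
    ((hft1.continuous_fderiv one_ne_zero).clm_apply continuous_const).comp
      (Continuous.prodMk_right s)
  have hcftx : Continuous (ftx s) :=
    ((hft1.continuous_fderiv one_ne_zero).clm_apply continuous_const).comp
      (Continuous.prodMk_right s)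
  have hcfxx : Continuous (fxx s) :=
    ((hfx1.continuous_fderiv one_ne_zero).clm_apply continuous_const).comp
      (Continuous.prodMk_right s)
  have hcχ : Continuous fun x => χ (x - s) := hχ.continuous.comp (continuous_id.sub continuous_const)
  have hcχ' : Continuous fun x => deriv χ (x - s) :=
    (hχ.continuous_deriv le_rfl).comp (continuous_id.sub continuous_const)
  have hVc : Continuous V := hV.continuous
  -- the integration by parts `∫ χ ∂ₓ(φ_t φ_x) = -∫ χ' φ_t φ_x`
  have hIBP : ∫ x, χ (x - s) * (ftx s x * fx s x + ft s x * fxx s x)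
      = -∫ x, deriv χ (x - s) * (ft s x * fx s x) := by
    have hv : ∀ x, HasDerivAt (fun y => ft s y * fx s y) (ftx s x * fx s x + ft s x * fxx s x) x :=
      fun x => hasDerivAt_flux_space hφ s x
    have hu : ∀ x, HasDerivAt (fun y => χ (y - s)) (deriv χ (x - s)) x := by
      intro x
      have hi : HasDerivAt (fun y : ℝ => y - s) 1 x := by
        simpa using (hasDerivAt_id x).sub_const s
      have h := ((hχ.differentiable one_ne_zero) (x - s)).hasDerivAt.comp x hi
      exact (h.congr_of_eventuallyEq (Eventually.of_forall fun t => rfl)).congr_deriv (by ring)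
    have hv0 : ∀ x, (x < α - |s| ∨ β + |s| < x) → ft s x * fx s x = 0 := by
      intro x hx; simp [(hout x hx).2.1]
    have hv'0 : ∀ x, (x < α - |s| ∨ β + |s| < x) → ftx s x * fx s x + ft s x * fxx s x = 0 := by
      intro x hx; simp [(hout x hx).2.1, (hout x hx).2.2.1]
    have huv0 : ∀ x, (x < α - |s| ∨ β + |s| < x) → χ (x - s) * (ft s x * fx s x) = 0 := by
      intro x hx; simp [hv0 x hx]
    obtain ⟨hbot, htop⟩ := tendsto_zero_of_exterior huv0
    have h := integral_mul_deriv_eq_deriv_mul (u := fun y => χ (y - s))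
      (v := fun y => ft s y * fx s y) (u' := fun x => deriv χ (x - s))
      (v' := fun x => ftx s x * fx s x + ft s x * fxx s x)
      (fun x _ => hu x) (fun x _ => hv x) ?_ ?_ hbot htop
    · simpa using h
    · exact integrable_of_exterior (a := α - |s|) (b := β + |s|)
        (hcχ.mul ((hcftx.mul hcfx).add (hcft.mul hcfxx))) (fun x hx => by simp [hv'0 x hx])
    · exact integrable_of_exterior (a := α - |s|) (b := β + |s|)
        (hcχ'.mul (hcft.mul hcfx)) (fun x hx => by simp [hv0 x hx])
  -- assemble
  have hA : Integrable fun x => 2 * χ (x - s) * (ft s x * (ftt s x - fxx s x + V x * φ s x))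
      - deriv χ (x - s) * ((ft s x ^ 2 + fx s x ^ 2 + V x * φ s x ^ 2)
        + 2 * (ft s x * fx s x)) := by
    refine integrable_of_exterior (a := α - |s|) (b := β + |s|) ?_ (fun x hx => ?_)
    · exact ((continuous_const.mul hcχ).mul (hcft.mul ((hcftt.sub hcfxx).add
        (hVc.mul hcφ)))).sub (hcχ'.mul ((((hcft.pow 2).add (hcfx.pow 2)).add
          (hVc.mul (hcφ.pow 2))).add (continuous_const.mul (hcft.mul hcfx))))
    · simp [(hout x hx).1, (hout x hx).2.1, (hout x hx).2.2.1]
  have hB : Integrable fun x => 2 * (χ (x - s) * (ftx s x * fx s x + ft s x * fxx s x)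
      + deriv χ (x - s) * (ft s x * fx s x)) := by
    refine integrable_of_exterior (a := α - |s|) (b := β + |s|) ?_ (fun x hx => ?_)
    · exact continuous_const.mul ((hcχ.mul ((hcftx.mul hcfx).add (hcft.mul hcfxx))).add
        (hcχ'.mul (hcft.mul hcfx)))
    · simp [(hout x hx).2.1, (hout x hx).2.2.1]
  have hBint : ∫ x, 2 * (χ (x - s) * (ftx s x * fx s x + ft s x * fxx s x)
      + deriv χ (x - s) * (ft s x * fx s x)) = 0 := by
    rw [integral_const_mul, integral_add, hIBP]
    · ring
    · exact integrable_of_exterior (a := α - |s|) (b := β + |s|)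
        (hcχ.mul ((hcftx.mul hcfx).add (hcft.mul hcfxx)))
        (fun x hx => by simp [(hout x hx).2.1, (hout x hx).2.2.1])
    · exact integrable_of_exterior (a := α - |s|) (b := β + |s|) (hcχ'.mul (hcft.mul hcfx))
        (fun x hx => by simp [(hout x hx).2.1])
  have hval : ∫ x, deriv (fun t => Φ t x) s
      = ∫ x, (2 * χ (x - s) * (ft s x * (ftt s x - fxx s x + V x * φ s x))
        - deriv χ (x - s) * ((ft s x ^ 2 + fx s x ^ 2 + V x * φ s x ^ 2)
          + 2 * (ft s x * fx s x))) := by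
    rw [hderiv_eq, integral_add hA hB, hBint, add_zero]
  rw [hval] at hD
  exact hD

/-- **The energy identity**: `d/dt ∫ e = 2 ∫ φ_t F` (weight `χ ≡ 1`). -/
theorem hasDerivAt_energy (hφ : ContDiff ℝ 2 (uncurry φ)) (hV : ContDiff ℝ 1 V)
    (h0 : ∀ t x, (x < α - |t| ∨ β + |t| < x) → φ t x = 0) (s : ℝ) :
    HasDerivAt (fun s => ∫ x, (fderiv ℝ (uncurry φ) (s, x) (1, 0) ^ 2
        + fderiv ℝ (uncurry φ) (s, x) (0, 1) ^ 2 + V x * φ s x ^ 2))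
      (∫ x, 2 * (fderiv ℝ (uncurry φ) (s, x) (1, 0)
          * (fderiv ℝ (uncurry fun t y => fderiv ℝ (uncurry φ) (t, y) (1, 0)) (s, x) (1, 0)
            - fderiv ℝ (uncurry fun t y => fderiv ℝ (uncurry φ) (t, y) (0, 1)) (s, x) (0, 1)
            + V x * φ s x))) s := by
  have h := hasDerivAt_weightedEnergy hφ hV h0 (χ := fun _ => (1 : ℝ)) contDiff_const s
  simp only [one_mul, deriv_const', zero_mul, sub_zero] at h
  refine h.congr_deriv ?_
  congr 1
  funext x
  ring

end WeightedEnergy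

end Summit.FinalStateConjecture.FinalStateConjecture.Theorems.Blindness

end
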